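import Summits.Ventures.HSemireg.WeilFamilyLieSpan
import Mathlib.LinearAlgebra.Multilinear.Basic
import Mathlib.LinearAlgebra.Alternating.Basic
import HarnessLib

/-!
# Venture HSemireg — multilinear forms killed by every Weil direction are killed by `𝔰𝔲(H)`

Continuation of `WeilFamilyBracket` / `WeilFamilyLieSpan`. The infinitesimal action of an endomorphism
`X` of a vector space `V` on a multilinear form `κ : V × ⋯ × V → N` is the DERIVATION
`(D_X κ)(v₁, …, v_k) = Σ_i κ(v₁, …, X v_i, …, v_k)`; on `H^k(A, ℝ) = {alternating k-forms on H₁(A, ℝ)}`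
this is the Gauss–Manin derivative of a class along a first-order deformation of the complex structure
(that identification is the cell's hand dictionary and is NOT made here). This file proves, def-free
(the action is written out as the sum `Σ_i κ(update v i (X (v i)))`):

* `sum_sum_update_comm` — the commutator identity `D_f D_g κ − D_g D_f κ = D_{g∘f − f∘g} κ` for
  arbitrary maps `f, g : V → V` (pure multilinearity; no linearity of `f, g` needed);
* `deriv_comm_eq_zero` — hence the annihilator `{X : D_X κ = 0}` is closed under commutators;
* `deriv_eq_zero_of_forall_offDiag` (**the form-level Lie step of THEOREM T (3a) / THEOREM CC (S5♯)**):
  on `U = P × P` (van Geemen's model, `dim_ℂ P ≥ 1`), a real multilinear form `κ` with `D_{T_B} κ = 0`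
  for every Weil direction `T_B` satisfies `D_X κ = 0` for every `X ∈ 𝔰𝔲(H)` (block shape
  `[[S, C†],[C, T]]`, `S, T` skew-adjoint, `tr S + tr T = 0`) — by `blocks_mem_of_commutator_closed`
  applied to the annihilator subspace; `deriv_eq_zero_of_forall_offDiag_alternating` is the same for
  ALTERNATING forms (`H^k(A, ℝ) = ⋀^k H₁(A, ℝ)^*`);
* `alternating_two_form_eq_smul_riemannForm` — BRIDGE to the Literature file's invariant-theory step
  ([vG94] Thm 6.12, `p = 1`, `exists_eq_smul_riemannForm_of_forall_offDiag`): an alternating 2-form killed by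
  every Weil direction (in this file's spelling) is a real multiple of the Riemann form `E = Im H` — so for
  DIVISOR classes the whole Lie-plus-invariant step is a tree theorem.

HONEST FRAMING. Elementary (multi)linear algebra; Lean index of the computation cell `pub-hsemireg`,
seat `w1-tw-1` (W1), note `widen/W1/CLEAN-COMPONENT-THEOREM-w1tw1.md` §10. With this file the chain
«a class killed (to first order) by every Weil direction is killed by 𝔰𝔲(H)» is kernel AT THE LEVEL OF
FORMS; what stays printed/hand is (a) the dictionary «⟨ξ, ·⟩ on H^{p,p} = the (p−1,p+1)-part of D_ξ on
real forms» and (b) «killed by 𝔰𝔲(H) ⇒ SU(H)-invariant ⇒ in T^{2p}» ([vG94] Thm 6.12). No abelian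
variety, Hodge class or semiregularity map appears in this file; nothing here says that HC, HC_CM or
HC_AV holds, and nothing here is a new case of anything.
-/

noncomputable section

open Complex Module Function
open scoped InnerProductSpace ComplexConjugate

namespace Summit.Ventures.HSemireg

namespace WeilFamily

open Literature.AlgebraicGeometry.HodgeTheory.WeilFamily

/-! ### The derivation action of maps on multilinear forms: the commutator identity -/

section Deriv

variable {ι V N : Type*} [Fintype ι] [DecidableEq ι] [AddCommGroup V] [Module ℝ V]
  [AddCommGroup N] [Module ℝ N]

/-- **Commutator identity for the derivation action.** For ANY maps `f, g : V → V`, a multilinear `κ`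
and `v`: `Σ_i Σ_j κ(… f v_i … g (·)_j …) − Σ_i Σ_j κ(… g v_i … f (·)_j …) = Σ_i κ(… (g f − f g) v_i …)`,
i.e. `D_f (D_g κ) − D_g (D_f κ) = D_{g∘f − f∘g} κ`: the off-diagonal terms cancel in pairs, the diagonal
ones combine by multilinearity. [folklore] -/
theorem sum_sum_update_comm (κ : MultilinearMap ℝ (fun _ : ι => V) N) (f g : V → V) (v : ι → V) :
    (∑ i, ∑ j, κ (update (update v i (f (v i))) j (g (update v i (f (v i)) j)))) -
      (∑ i, ∑ j, κ (update (update v i (g (v i))) j (f (update v i (g (v i)) j)))) =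
      ∑ i, κ (update v i (g (f (v i)) - f (g (v i)))) := by
  -- off-diagonal symmetry
  have hoff : ∀ i j, i ≠ j →
      update (update v i (f (v i))) j (g (update v i (f (v i)) j)) =
        update (update v j (g (v j))) i (f (update v j (g (v j)) i)) := by
    intro i j hij
    rw [update_of_ne (Ne.symm hij), update_of_ne hij, update_comm hij]
  -- diagonal values
  have hdiag : ∀ (h k : V → V) (i : ι),
      update (update v i (h (v i))) i (k (update v i (h (v i)) i)) = update v i (k (h (v i))) := by
    intro h k i
    rw [update_self, update_idem]
  rw [Finset.sum_comm (f := fun i j => κ (update (update v i (g (v i))) j (f (update v i (g (v i)) j)))),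
    ← Finset.sum_sub_distrib]
  refine Finset.sum_congr rfl fun i _ => ?_
  rw [← Finset.sum_sub_distrib, Finset.sum_eq_single i]
  · rw [hdiag f g i, hdiag g f i, ← MultilinearMap.map_update_sub]
  · intro j _ hji
    rw [hoff i j (Ne.symm hji), sub_self]
  · intro hi
    exact absurd (Finset.mem_univ i) hi

/-- Hence the annihilator of `κ` under the derivation action is closed under commutators: if
`D_f κ = 0` and `D_g κ = 0` (pointwise) then `D_{f∘g − g∘f} κ = 0`. [folklore] -/
theorem deriv_comm_eq_zero (κ : MultilinearMap ℝ (fun _ : ι => V) N) {f g : V → V}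
    (hf : ∀ v : ι → V, ∑ i, κ (update v i (f (v i))) = 0)
    (hg : ∀ v : ι → V, ∑ i, κ (update v i (g (v i))) = 0) (v : ι → V) :
    ∑ i, κ (update v i (f (g (v i)) - g (f (v i)))) = 0 := by
  have h := sum_sum_update_comm κ g f v
  simp only [hf, hg, Finset.sum_const_zero, sub_zero] at h
  exact h.symm

end Deriv

/-! ### Forms on `U = P × P` killed by `𝔭` are killed by `𝔰𝔲(H)` -/

variable {P : Type*} [NormedAddCommGroup P] [InnerProductSpace ℂ P] [FiniteDimensional ℂ P]

/-- **The form-level Lie step.** Let `dim_ℂ P ≥ 1` and let `κ` be a real `ι`-multilinear form on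
`U = P × P` with values in a real vector space `N` such that `D_{T_B} κ = 0` for every Weil direction
`T_B (x₁,x₂) = (B† x₂, B x₁)`, i.e. `Σ_i κ(v₁, …, T_B v_i, …) = 0` for all `B` and all `v`. Then
`D_X κ = 0` for every `X` of block shape `[[S, C†],[C, T]] = S.prodMap T + T_C` with `S, T` skew-adjoint
and `tr S + tr T = 0` — i.e. for every `X ∈ 𝔰𝔲(H)` (`hermForm_blocks`, `trace_blocks`). Proof: the
annihilator `{X : D_X κ = 0}` is a real subspace of `End_ℂ(P × P)` containing every `T_B` and closed under
commutators (`deriv_comm_eq_zero`), so `blocks_mem_of_commutator_closed` applies. [folklore] -/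
theorem deriv_eq_zero_of_forall_offDiag (h1 : 1 ≤ finrank ℂ P) {ι N : Type*} [Fintype ι] [DecidableEq ι]
    [AddCommGroup N] [Module ℝ N] (κ : MultilinearMap ℝ (fun _ : ι => P × P) N)
    (hκ : ∀ (B : P →ₗ[ℂ] P) (v : ι → P × P), ∑ i, κ (update v i (offDiag B (v i))) = 0)
    {S T : P →ₗ[ℂ] P} (C : P →ₗ[ℂ] P) (hS : LinearMap.adjoint S = -S) (hT : LinearMap.adjoint T = -T)
    (htr : LinearMap.trace ℂ P S + LinearMap.trace ℂ P T = 0) (v : ι → P × P) :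
    ∑ i, κ (update v i
      ((S.prodMap T + (LinearMap.adjoint C).prodMap C ∘ₗ (LinearEquiv.prodComm ℂ P P).toLinearMap) (v i))) =
      0 := by
  let K : Submodule ℝ (Module.End ℂ (P × P)) :=
    { carrier := {X | ∀ v : ι → P × P, ∑ i, κ (update v i (X (v i))) = 0}
      add_mem' := fun {X Y} hX hY v => by
        simp only [LinearMap.add_apply, MultilinearMap.map_update_add, Finset.sum_add_distrib, hX v,
          hY v, add_zero]
      zero_mem' := fun v => by
        simp only [LinearMap.zero_apply, MultilinearMap.map_update_zero, Finset.sum_const_zero]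
      smul_mem' := fun r {X} hX v => by
        have e : ∀ i, (r • X) (v i) = r • X (v i) := fun i => rfl
        simp only [e, MultilinearMap.map_update_smul, ← Finset.smul_sum, hX v, smul_zero] }
  have hK𝔭 : ∀ B : P →ₗ[ℂ] P,
      ((LinearMap.adjoint B).prodMap B ∘ₗ (LinearEquiv.prodComm ℂ P P).toLinearMap :
        Module.End ℂ (P × P)) ∈ K := by
    intro B v
    simpa only [prodMap_adjoint_comp_prodComm_apply] using hκ B v
  have hKc : ∀ X Y : Module.End ℂ (P × P), X ∈ K → Y ∈ K → X * Y - Y * X ∈ K := by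
    intro X Y hX hY v
    simpa only [LinearMap.sub_apply, Module.End.mul_apply] using deriv_comm_eq_zero κ hX hY v
  have hmem := blocks_mem_of_commutator_closed K hK𝔭 hKc h1 C hS hT htr
  exact hmem v

/-- The same for ALTERNATING forms (real cohomology classes of the torus `U/Λ` are alternating forms on
`U`): an alternating `ι`-form on `U = P × P` killed by every Weil direction is killed by all of `𝔰𝔲(H)`.
[folklore] -/
theorem deriv_eq_zero_of_forall_offDiag_alternating (h1 : 1 ≤ finrank ℂ P) {ι N : Type*} [Fintype ι]
    [DecidableEq ι] [AddCommGroup N] [Module ℝ N] (κ : (P × P) [⋀^ι]→ₗ[ℝ] N)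
    (hκ : ∀ (B : P →ₗ[ℂ] P) (v : ι → P × P), ∑ i, κ (update v i (offDiag B (v i))) = 0)
    {S T : P →ₗ[ℂ] P} (C : P →ₗ[ℂ] P) (hS : LinearMap.adjoint S = -S) (hT : LinearMap.adjoint T = -T)
    (htr : LinearMap.trace ℂ P S + LinearMap.trace ℂ P T = 0) (v : ι → P × P) :
    ∑ i, κ (update v i
      ((S.prodMap T + (LinearMap.adjoint C).prodMap C ∘ₗ (LinearEquiv.prodComm ℂ P P).toLinearMap) (v i))) =
      0 := by
  have h := deriv_eq_zero_of_forall_offDiag h1 κ.toMultilinearMap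
    (fun B w => by simpa only [AlternatingMap.coe_multilinearMap] using hκ B w) C hS hT htr v
  simpa only [AlternatingMap.coe_multilinearMap] using h

/-- BRIDGE to the Literature file's classification of invariant 2-forms ([vG94] 6.12, `p = 1`): an
ALTERNATING 2-form on `U = P × P` killed by every Weil direction (in the `Σ_i κ(update v i (T_B (v i)))`
spelling of this file) is a real multiple of the Riemann form `E = Im H`. So for divisor classes
(`c = 1`) the whole step (S5♯) — «killed by 𝔭 ⇒ a generic class» — is a tree theorem. [folklore] -/
theorem alternating_two_form_eq_smul_riemannForm (h2 : 2 ≤ finrank ℂ P)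
    (κ : (P × P) [⋀^Fin 2]→ₗ[ℝ] ℝ)
    (hκ : ∀ (B : P →ₗ[ℂ] P) (v : Fin 2 → P × P), ∑ i, κ (update v i (offDiag B (v i))) = 0) :
    ∃ c : ℝ, ∀ x y : P × P, κ ![x, y] = c * riemannForm x y := by
  have u0 : ∀ x y a : P × P, update ![x, y] 0 a = ![a, y] := by
    intro x y a; funext i; fin_cases i <;> simp
  have u1 : ∀ x y a : P × P, update ![x, y] 1 a = ![x, a] := by
    intro x y a; funext i; fin_cases i <;> simp
  -- the bilinear form `E' x y := κ ![x, y]`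
  let E' : (P × P) →ₗ[ℝ] (P × P) →ₗ[ℝ] ℝ :=
    LinearMap.mk₂ ℝ (fun x y => κ ![x, y])
      (fun x x' y => by
        have h := κ.map_update_add ![x, y] 0 x x'
        rw [u0, u0, u0] at h
        exact h)
      (fun r x y => by
        have h := κ.map_update_smul ![x, y] 0 r x
        rw [u0, u0, smul_eq_mul] at h
        exact h)
      (fun x y y' => by
        have h := κ.map_update_add ![x, y] 1 y y'
        rw [u1, u1, u1] at h
        exact h)
      (fun r x y => by
        have h := κ.map_update_smul ![x, y] 1 r y
        rw [u1, u1, smul_eq_mul] at h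
        exact h)
  have hE' : ∀ x y, E' x y = κ ![x, y] := fun x y => rfl
  have halt : ∀ x, E' x x = 0 := fun x =>
    κ.map_eq_zero_of_eq ![x, x] (by simp) (show (0 : Fin 2) ≠ 1 by decide)
  have hinv : ∀ (B : P →ₗ[ℂ] P) (x y : P × P), E' (offDiag B x) y + E' x (offDiag B y) = 0 := by
    intro B x y
    have h := hκ B ![x, y]
    rw [Fin.sum_univ_two] at h
    simp only [Matrix.cons_val_zero, Matrix.cons_val_one, u0, u1] at h
    rw [hE', hE']
    exact h
  obtain ⟨c, hc⟩ := exists_eq_smul_riemannForm_of_forall_offDiag E' h2 halt hinv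
  exact ⟨c, fun x y => by rw [← hE']; exact hc x y⟩

end WeilFamily

end Summit.Ventures.HSemireg
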